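import Literature.MathematicalPhysics.QuantumFieldTheory.ConformalBootstrap3D.PointKernelK57Data

/-!
# K57 certificate, kernel block file H24: head segments `211 ≤ i < 217` (block-checked ones)

`decide` by kernel reduction (no `native_decide`, no extra axioms) of the block checker
`PCert.hBlockOK` of `PointKernel` on the literal data of `PointKernelK57Data` (cells checked corner
or chord by the rule bit); soundness is `PCert.hBlockOK_sound`.  Estimated kernel time 196 s
(5 theorems).
-/

set_option maxRecDepth 100000
set_option maxHeartbeats 0

namespace Literature.MathematicalPhysics.QuantumFieldTheory.ConformalBootstrap3D.PointKernelK57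

open Literature.MathematicalPhysics.QuantumFieldTheory.ConformalBootstrap3D.PointKernel

/-- head segment `[211, 212)` passes the kernel evaluator (≈37 s of kernel work). [folklore] -/
theorem hBlock_211 : certK57.hBlockOK hsegsK57 211 212 JHK57 = true := by
  decide +kernel

/-- head segment `[212, 213)` passes the kernel evaluator (≈30 s of kernel work). [folklore] -/
theorem hBlock_212 : certK57.hBlockOK hsegsK57 212 213 JHK57 = true := by
  decide +kernel

/-- head segment `[213, 214)` passes the kernel evaluator (≈30 s of kernel work). [folklore] -/
theorem hBlock_213 : certK57.hBlockOK hsegsK57 213 214 JHK57 = true := by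
  decide +kernel

/-- head segment `[214, 215)` passes the kernel evaluator (≈36 s of kernel work). [folklore] -/
theorem hBlock_214 : certK57.hBlockOK hsegsK57 214 215 JHK57 = true := by
  decide +kernel

/-- head segments `[215, 217)` pass the kernel evaluator (≈45 s of kernel work). [folklore] -/
theorem hBlock_215 : certK57.hBlockOK hsegsK57 215 217 JHK57 = true := by
  decide +kernel

end Literature.MathematicalPhysics.QuantumFieldTheory.ConformalBootstrap3D.PointKernelK57
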